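import Literature.Computability.Cryptography.ShorAssemblyLeavesProofs
import Literature.Computability.Cryptography.QSolvableParitySum
import Literature.Computability.QuantumComplexity.CWrapKernelRel
import Literature.Computability.QuantumComplexity.PromiseWrap
import Literature.Computability.QuantumComplexity.SeqChainLaw
import Literature.Computability.QuantumComplexity.SeqChainUniform
import Literature.Computability.Complexity.OracleClosure
import HarnessLib

/-!
# Pre-processing with a `BQP` oracle inside bounded-error quantum search

Topic `Literature/Computability/QuantumComplexity`; the oracle companion of the classical wrap
`Literature.Computability.Cryptography.isQSolvable_classicalWrap` (`Cryptography/ShorProofs.lean`,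
discharged in `CWrapAssembly.lean`: `h, g ∈ FP`, `IsQSolvable R` ⟹ the problem "on input `x` output a
string with prefix `g ⟨x, y⟩`, `y ∈ R (h x)`" is `IsQSolvable`). Here the PRE-PROCESSOR may query an
oracle `A ∈ BQP`: `h ∈ FP^A` (`FPRel (Oracle.ofLanguage A)`). This is the shape of every "factor the
input with Shor's algorithm, then run ONE Fourier-sampling experiment on data computed from the
factorisation, then post-process classically" algorithm (Hallgren 2005, §1 and Thm. 1.1: the unit
group / regulator of a number field of constant degree, where the ring of integers is obtained from
the factorisation of the discriminant; Hallgren 2007, §5), and, as a complexity principle, the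
function form of `BQP^BQP = BQP` (Bennett–Bernstein–Brassard–Vazirani 1997, Cor. 4.15 with
Thm. 4.13–4.14) combined with "classical computation is free inside quantum machines"
(Bernstein–Vazirani 1997, §8 and §8.3).

* **`OracleWrap.exists_stageFamily`** — ONE poly-time uniform Clifford+`T` family `S` with oracle
  gates serving both stages of the algorithm on the stage inputs `⟨x, ⟨1ᵏ, y⟩⟩` of
  `StageChains.stageInput`: on `⟨x, ⟨1⁰, []⟩⟩` it writes the self-delimited value `⟨h x, []⟩`
  with probability `1` (the reversible simulation of the oracle machine of `h` on zero coins,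
  `kernelProb_ge_uniformProb_of_mem_FPRel_holds`, Bernstein–Vazirani 1997, Thm. 8.3 relativised);
  on `⟨x, ⟨1¹, y⟩⟩` with `⟨h x, []⟩ <+: y` it runs the given family `F` on `h x` and writes
  `g ⟨x, y'⟩` for its output `y'` (the relativised classical wrap `exists_uniform_classicalWrap_rel`);
  the two jobs are offered to one wrap as a parity sum (`QCircuitFamily.paritySum`).
* **`OracleWrap.isQSolvable_of_uniform`** — the main theorem: if `A ∈ BQP`, `h ∈ FP^A`, `g ∈ FP`,
  and a poly-time uniform family `F` (oracle gates for `A` allowed) outputs a string of `R u` on input `u`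
  with probability `≥ 2/3 + δ` (`δ > 0`), then `x ↦ {z | ∃ y ∈ R (h x), g ⟨x, y⟩ <+: z}` is
  `IsQSolvable`: the two stages are composed by the sequential chain combinator
  (`SeqChain.chainLaw_toOuterMeasure_le_kernel`, `SeqChain.family_isUniform`: deferred measurement,
  Nielsen–Chuang 2010, §4.4) with a window wide enough for `⟨h x, []⟩` and for `g ⟨x, y'⟩`, and the
  oracle gates are finally replaced by tidy deciders of `A`
  (`isQSolvable_of_mem_BQP_oracle_holds`, Bennett–Bernstein–Brassard–Vazirani 1997, Thm. 4.14).
* `OracleWrap.isQSolvable_of_isOracleFree`, `OracleWrap.isQSolvable_of_slack` — the readings for an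
  oracle-free solver of `R` with success probability bounded away from `2/3`.

Design note. The slack `δ > 0` cannot be dropped for a general relation `R`: the simulation of the
oracle answers by bounded-error deciders costs probability, and a bare `2/3` would have to be
re-amplified, which is unavailable for search problems whose answers cannot be checked or voted on
(the same remark as for `Cryptography.isQSolvable_of_mem_BQP_oracle`). Everything here is proved; no
definition and no named fact is introduced.

## References

* C. H. Bennett, E. Bernstein, G. Brassard, U. Vazirani, *Strengths and weaknesses of quantum
  computing*, SIAM J. Comput. 26 (1997) 1510–1523, Thm. 4.13, Thm. 4.14, Cor. 4.15 (`BQP^BQP = BQP`)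
  [BennettBernsteinBrassardVazirani1997].
* E. Bernstein, U. Vazirani, *Quantum complexity theory*, SIAM J. Comput. 26 (1997) 1411–1473, §8
  (classical computation and subroutine calls inside quantum machines), Thm. 8.3, §8.3 (oracle QTMs)
  [BernsteinVazirani1997SICOMP], [BernsteinVazirani1997].
* M. A. Nielsen, I. L. Chuang, *Quantum Computation and Quantum Information*, CUP 2010, §4.4
  (principle of deferred measurement) [NielsenChuang2010].
* S. Hallgren, *Fast quantum algorithms for computing the unit group and class group of a number
  field*, STOC 2005, §1 [Hallgren2005].
-/

noncomputable section

namespace Literature.Computability.QuantumComplexity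

namespace OracleWrap

open _root_.Computability Complexity Complexity.Brick Cryptography Polynomial

/-! ### Generic lemmas on output kernels -/

/-- An event of probability `≥ 1` (under the output kernel of a family) contains every possible
output. [folklore] -/
theorem support_subset_of_one_le_kernelProb (F : QCircuitFamily cliffordT) (A : Language Bool)
    (x : List Bool) {E : Set (List Bool)} (h : 1 ≤ F.kernelProb A x E) : (F.kernel A x).support ⊆ E := by
  have hle : (F.kernel A x).toOuterMeasure E ≤ 1 :=
    ((F.kernel A x).toOuterMeasure.mono (Set.subset_univ E)).trans_eq
      (((F.kernel A x).toOuterMeasure_apply_eq_one_iff _).2 (Set.subset_univ _))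
  rw [← PMF.toOuterMeasure_apply_eq_one_iff]
  refine le_antisymm hle ?_
  rw [← ENNReal.ofReal_one]
  exact (ENNReal.ofReal_le_iff_le_toReal (ne_top_of_le_ne_top ENNReal.one_ne_top hle)).2 h

/-- The semantics of an oracle-free family does not depend on the oracle.
[cite: BernsteinVazirani1997, §8] -/
theorem kernel_eq_of_isOracleFree {F : QCircuitFamily cliffordT} (hF : F.IsOracleFree)
    (A B : Language Bool) (x : List Bool) : F.kernel A x = F.kernel B x := by
  unfold QCircuitFamily.kernel QCircuit.outputPMF QCircuit.runOn
  rw [QCircuit.toMatrix_eq_of_isOracleFree (hF x.length) A B]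

/-- A prefix that fits into the window is a prefix of the window. [folklore] -/
theorem prefix_takeD {a w : List Bool} (h : a <+: w) {m : ℕ} (hm : a.length ≤ m) :
    a <+: w.takeD m false := by
  obtain ⟨t, rfl⟩ := h
  rw [SeqChain.takeD_eq_take_append, List.take_append, List.take_of_length_le hm, List.append_assoc]
  exact List.prefix_append _ _

/-- **A two-stage Markov bound**: if the first law is supported in `P₀` and from every point of `P₀`
the second stage hits `E` with probability `≥ c`, the composite hits `E` with probability `≥ c`.
[folklore] -/
theorem le_toOuterMeasure_bind {p : PMF (List Bool)} {q : List Bool → PMF (List Bool)}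
    {P₀ E : Set (List Bool)} {c : ENNReal} (hp : p.support ⊆ P₀)
    (hq : ∀ y ∈ P₀, c ≤ (q y).toOuterMeasure E) : c ≤ (p.bind q).toOuterMeasure E := by
  rw [PMF.toOuterMeasure_bind_apply]
  calc c = (∑' y, p y) * c := by rw [PMF.tsum_coe, one_mul]
    _ = ∑' y, p y * c := ENNReal.tsum_mul_right.symm
    _ ≤ ∑' y, p y * (q y).toOuterMeasure E := by
      refine ENNReal.tsum_le_tsum fun y => ?_
      by_cases hy : p y = 0
      · rw [hy, zero_mul, zero_mul]
      · exact mul_le_mul_right (hq y (hp ((PMF.mem_support_iff _ _).2 hy))) _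

/-! ### The stage family -/

/-- **The stage family of the oracle wrap.** For `h ∈ FP^{A₀}`, `g ∈ FP` and a poly-time uniform
family `F` (oracle gates allowed) there is ONE poly-time uniform Clifford+`T` family `S` such that

* on the stage input `⟨x, ⟨1⁰, []⟩⟩`, relative to `A₀`, the measured register has the prefix
  `⟨h x, []⟩` with probability `1`;
* on a stage input `⟨x, ⟨1¹, y⟩⟩` with `⟨h x, []⟩ <+: y`, relative to ANY oracle `A` and for
  every event `Ev`, the measured register has a prefix `g ⟨x, t⟩`, `t ∈ Ev`, with probability at least
  `Pr[F on h x outputs a string of Ev]`.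

Construction: the stage wrap (`exists_uniform_classicalWrap_rel`) sends `⟨x, ⟨1ᵏ, y⟩⟩` to
`⟨⟨x, fstF y⟩, 1ᵏ⟩` — even length for `k = 0`, odd for `k = 1` — into the parity sum
(`QCircuitFamily.paritySum`) of the zero-coin reversible simulation of the oracle machine of
`u ↦ ⟨h (fstF (fstF (fstF u))), []⟩` (`kernelProb_ge_uniformProb_of_mem_FPRel_holds`) and of the wrap
of `F` reading `sndF (fstF ·)` and post-processed by `g ⟨fstF (fstF (fstF ·)), sndF ·⟩`, and copies
the answer.
[cite: BernsteinVazirani1997SICOMP, §8.2–8.3 and Thm. 8.3 (subroutines inside oracle QTMs)] -/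
theorem exists_stageFamily (A₀ : Language Bool) {h g : List Bool → List Bool}
    (hh : h ∈ FPRel (Oracle.ofLanguage A₀)) (hg : g ∈ FP) {F : QCircuitFamily cliffordT}
    (hU : F.IsUniform) :
    ∃ S : QCircuitFamily cliffordT, S.IsUniform ∧
      (∀ x, 1 ≤ S.kernelProb A₀ (stageInput x 0 []) {w | boolPair (h x) [] <+: w}) ∧
      (∀ (A : Language Bool) (x y : List Bool), boolPair (h x) [] <+: y → ∀ Ev : Set (List Bool),
        F.kernelProb A (h x) Ev ≤
          S.kernelProb A (stageInput x 1 y) {w | ∃ t ∈ Ev, g (boolPair x t) <+: w}) := by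
  have hp3 : (fstF ∘ fstF ∘ fstF : List Bool → List Bool) ∈ FP :=
    comp_mem_FP fstF_mem_FP (comp_mem_FP fstF_mem_FP fstF_mem_FP)
  have hsd : (fanoutFn (fun z => z) (fun _ => ([] : List Bool))) ∈ FP :=
    fanoutFn_mem_FP (PolyTimeComputable.id _) (const_mem_FP _)
  -- stage 0: the zero-coin oracle computation writing `⟨h x, []⟩`
  set G₀ : List Bool → List Bool :=
    fanoutFn (fun z => z) (fun _ => ([] : List Bool)) ∘ (h ∘ (fstF ∘ fstF ∘ fstF)) with hG₀
  have hG₀mem : G₀ ∈ FPRel (Oracle.ofLanguage A₀) := FP_comp_mem_FPRel (comp_FP_mem_FPRel hh hp3) hsd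
  obtain ⟨F₀, hU₀, hF₀⟩ := kernelProb_ge_uniformProb_of_mem_FPRel_holds A₀ G₀ 0 hG₀mem
  -- stage 1: the given family on `u`, read off `⟨⟨x, u⟩, c⟩`, post-processed by `g ⟨x, ·⟩`
  have hpre₁ : (sndF ∘ fstF : List Bool → List Bool) ∈ FP := comp_mem_FP sndF_mem_FP fstF_mem_FP
  have hpost₁ : (g ∘ fanoutFn (fstF ∘ fstF ∘ fstF) sndF) ∈ FP :=
    comp_mem_FP hg (fanoutFn_mem_FP hp3 sndF_mem_FP)
  obtain ⟨F₁, hU₁, hF₁⟩ := exists_uniform_classicalWrap_rel hpre₁ hpost₁ hU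
  -- the dispatcher
  have hpre : (fanoutFn (fanoutFn fstF (fstF ∘ sndF ∘ sndF)) (fstF ∘ sndF)) ∈ FP :=
    fanoutFn_mem_FP (fanoutFn_mem_FP fstF_mem_FP
      (comp_mem_FP fstF_mem_FP (comp_mem_FP sndF_mem_FP sndF_mem_FP)))
      (comp_mem_FP fstF_mem_FP sndF_mem_FP)
  obtain ⟨S, hUS, hS⟩ := exists_uniform_classicalWrap_rel hpre sndF_mem_FP
    (QCircuitFamily.paritySum_isUniform hU₀ hU₁)
  have hpre_apply : ∀ (x y : List Bool) (k : ℕ),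
      fanoutFn (fanoutFn fstF (fstF ∘ sndF ∘ sndF)) (fstF ∘ sndF) (stageInput x k y) =
        boolPair (boolPair x (fstF y)) (List.replicate k true) := by
    intro x y k
    simp only [stageInput, fanoutFn_apply, Function.comp_apply, fstF_boolPair, sndF_boolPair]
  refine ⟨S, hUS, fun x => ?_, fun A x y hy Ev => ?_⟩
  · -- stage 0
    have hfst : fstF ([] : List Bool) = [] := rfl
    have heven : Even (boolPair (boolPair x []) []).length :=
      ⟨(boolPair x []).length + 1, by rw [length_boolPair _ [], List.length_nil]; omega⟩
    have h0 := hS A₀ (stageInput x 0 []) {w | boolPair (h x) [] <+: w}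
    rw [hpre_apply, hfst, List.replicate_zero,
      QCircuitFamily.kernelProb_paritySum_of_even A₀ heven] at h0
    have h1 := hF₀ (boolPair (boolPair x []) []) {boolPair (h x) []}
    have hG₀val : G₀ (boolPair (boolPair (boolPair x []) []) []) = boolPair (h x) [] := by
      simp only [hG₀, Function.comp_apply, fanoutFn_apply, fstF_boolPair]
    -- with no coin the uniform coin measure is the point mass at `[]`
    have hcoin : ∀ E : Set (List Bool), [] ∈ E → uniformProb 0 E = 1 := by
      intro E hE
      classical
      unfold uniformProb
      rw [Finset.filter_true_of_mem, Finset.card_univ, card_vector, Fintype.card_bool]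
      · norm_num
      · intro r _
        have hr : r.toList = [] := List.eq_nil_of_length_eq_zero (by simp)
        rw [hr]
        exact hE
    rw [eval_zero, hcoin _ (by
      change G₀ (boolPair (boolPair (boolPair x []) []) []) ∈ ({boolPair (h x) []} : Set (List Bool))
      rw [hG₀val]; exact Set.mem_singleton _)] at h1
    have hset : {y : List Bool | ∃ s ∈ ({boolPair (h x) []} : Set (List Bool)), s <+: y} =
        {w | boolPair (h x) [] <+: w} := by
      ext y; simp
    rw [hset] at h1
    refine h1.trans (h0.trans (kernelProb_mono _ _ _ ?_))
    rintro w' ⟨w, hw, hw'⟩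
    rw [sndF_boolPair] at hw'
    exact hw.trans hw'
  · -- stage 1
    have hodd : ¬ Even (boolPair (boolPair x (h x)) [true]).length := by
      rw [Nat.not_even_iff_odd]
      exact ⟨(boolPair x (h x)).length + 1, by
        rw [length_boolPair _ [true], List.length_singleton]; omega⟩
    have h0 := hS A (stageInput x 1 y)
      {w | ∃ t ∈ Ev, (g ∘ fanoutFn (fstF ∘ fstF ∘ fstF) sndF)
        (boolPair (boolPair (boolPair x (h x)) [true]) t) <+: w}
    have hfst : fstF y = h x := by
      obtain ⟨t, rfl⟩ := hy
      rw [boolPair_append, List.nil_append, fstF_boolPair]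
    rw [hpre_apply, hfst, List.replicate_one,
      QCircuitFamily.kernelProb_paritySum_of_not_even A hodd] at h0
    have h1 := hF₁ A (boolPair (boolPair x (h x)) [true]) Ev
    have hpre₁val : (sndF ∘ fstF) (boolPair (boolPair x (h x)) [true]) = h x := by
      simp only [Function.comp_apply, fstF_boolPair, sndF_boolPair]
    rw [hpre₁val] at h1
    refine h1.trans (h0.trans (kernelProb_mono _ _ _ ?_))
    rintro w' ⟨w, ⟨t, ht, htw⟩, hw'⟩
    refine ⟨t, ht, ?_⟩
    have e : (g ∘ fanoutFn (fstF ∘ fstF ∘ fstF) sndF)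
        (boolPair (boolPair (boolPair x (h x)) [true]) t) = g (boolPair x t) := by
      simp only [Function.comp_apply, fanoutFn_apply, fstF_boolPair, sndF_boolPair]
    rw [sndF_boolPair] at hw'
    rw [e] at htw
    exact htw.trans hw'

/-! ### The main theorem -/

/-- **Pre-processing with a `BQP` oracle, one call of a quantum search family, classical
post-processing ⟹ `IsQSolvable`.** Let `A ∈ BQP`, `h ∈ FP^A` (`FPRel (Oracle.ofLanguage A)`),
`g ∈ FP`, and let `F` be a poly-time uniform Clifford+`T` family (oracle gates for `A` allowed)
which on input `u`, run with the oracle `A` and measured on all wires, outputs a string of `R u` with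
probability `≥ 2/3 + δ`, `δ > 0`. Then the search problem "on input `x`, output a string with prefix
`g ⟨x, y⟩` for some `y ∈ R (h x)`" is solvable in bounded-error quantum polynomial time by an
ORACLE-FREE uniform family (`IsQSolvable`). Proof: the stage family of `exists_stageFamily` is run
twice by the sequential chain combinator (`SeqChain.family`: stage `0` writes `⟨h x, []⟩`, surely;
stage `1` reads `h x` back from the window — the window `m(|x|)` is a polynomial exceeding
`|⟨h x, []⟩|` and `|g ⟨x, y⟩|` for every register content `y` of `F` on `h x` — and runs `F` and
`g`), its law is bounded below through `SeqChain.chainLaw_toOuterMeasure_le_kernel`, and the oracle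
gates of the (uniform, `SeqChain.family_isUniform`) chain family are removed by
`isQSolvable_of_mem_BQP_oracle_holds`, the slack `δ` absorbing the simulation error.
[cite: BennettBernsteinBrassardVazirani1997, Cor. 4.15 (BQP^BQP = BQP) with Thm. 4.13–4.14]
[cite: BernsteinVazirani1997SICOMP, §8 and Thm. 8.3 (classical computation inside quantum machines)] -/
theorem isQSolvable_of_uniform {A : Language Bool} (hA : A ∈ BQP) {h g : List Bool → List Bool}
    (hh : h ∈ FPRel (Oracle.ofLanguage A)) (hg : g ∈ FP) {R : List Bool → Set (List Bool)}
    {F : QCircuitFamily cliffordT} (hU : F.IsUniform) {δ : ℝ} (hδ : 0 < δ)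
    (hF : ∀ u, 2 / 3 + δ ≤ F.kernelProb A u (R u)) :
    IsQSolvable fun x => {z | ∃ y ∈ R (h x), g (boolPair x y) <+: z} := by
  obtain ⟨S, hUS, hS0, hS1⟩ := exists_stageFamily A hh hg hU
  obtain ⟨pS, hpS⟩ := QCircuitFamily.IsUniform.isPolySize_holds hUS
  obtain ⟨pF, hpF⟩ := QCircuitFamily.IsUniform.isPolySize_holds hU
  obtain ⟨pg, hpg⟩ := exists_poly_length_le_of_mem_FP hg
  -- the window polynomial and the chain parameters
  set B₀ : Polynomial ℕ := C 2 * X + C 4 + pS.comp (C 2 * X + C 4) with hB₀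
  set pm : Polynomial ℕ := B₀ + pg.comp (C 2 * X + C 2 + B₀ + pF.comp B₀) with hpm
  have hB₀eval : ∀ n, B₀.eval n = 2 * n + 4 + pS.eval (2 * n + 4) := fun n => by
    simp only [hB₀, eval_add, eval_mul, eval_C, eval_X, eval_comp]
  have hpmeval : ∀ n, pm.eval n = B₀.eval n + pg.eval (2 * n + 2 + B₀.eval n + pF.eval (B₀.eval n)) :=
    fun n => by simp only [hpm, eval_add, eval_mul, eval_C, eval_X, eval_comp]
  obtain ⟨P, hPS, hPT, hPm⟩ : ∃ P : SeqChain.Params, P.S = S ∧ P.T = C 2 ∧ P.m = pm :=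
    ⟨⟨S, pS, fun n => (hpS n).2, C 2, pm⟩, rfl, rfl, rfl⟩
  set Rel : List Bool → Set (List Bool) := fun x => {z | ∃ y ∈ R (h x), g (boolPair x y) <+: z}
    with hRel
  have hRelext : ∀ x, ∀ y ∈ Rel x, ∀ z, y <+: z → z ∈ Rel x :=
    fun x y ⟨t, ht, hty⟩ z hyz => ⟨t, ht, hty.trans hyz⟩
  refine isQSolvable_of_mem_BQP_oracle_holds A Rel (SeqChain.family P) δ hRelext hA
    (SeqChain.family_isUniform P (by rw [hPS]; exact hUS)) hδ fun x => ?_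
  -- sizes on input `x`
  have hne : ∀ (p : PMF (List Bool)) (E : Set (List Bool)), p.toOuterMeasure E ≠ ⊤ := fun p E =>
    ne_top_of_le_ne_top ENNReal.one_ne_top ((p.toOuterMeasure.mono (Set.subset_univ E)).trans_eq
      ((p.toOuterMeasure_apply_eq_one_iff _).2 (Set.subset_univ _)))
  have hlen : ∀ (F' : QCircuitFamily cliffordT) (u y : List Bool), y ∈ (F'.kernel A u).support →
      y.length = u.length + F'.ancillas u.length := fun F' u y hy => by
    obtain ⟨z, -, rfl⟩ := (PMF.mem_support_map_iff _ _ _).1 hy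
    exact List.length_ofFn
  set n := x.length with hn
  have hsupp0 : (S.kernel A (stageInput x 0 [])).support ⊆ {w | boolPair (h x) [] <+: w} :=
    support_subset_of_one_le_kernelProb S A _ (hS0 x)
  have hlen_sd : (boolPair (h x) []).length ≤ B₀.eval n := by
    obtain ⟨w₀, hw₀⟩ := (S.kernel A (stageInput x 0 [])).support_nonempty
    have h1 := (hsupp0 hw₀).length_le
    have h2 := hlen S _ _ hw₀
    have hz : (stageInput x 0 []).length = 2 * n + 4 := by
      simp only [stageInput, length_boolPair, List.length_replicate, List.length_nil, hn]
    rw [h2, hz] at h1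
    have h3 := (hpS (2 * n + 4)).2
    rw [hB₀eval]
    omega
  have hlen_hx : (h x).length ≤ B₀.eval n := by
    have : (boolPair (h x) []).length = 2 * (h x).length + 2 := by
      rw [length_boolPair, List.length_nil, Nat.add_zero]
    omega
  -- the chain law is bounded below by `2/3 + δ`
  have hc : ENNReal.ofReal (2 / 3 + δ) ≤ (chainLaw A S (pm.eval n) x (1 + 1)).toOuterMeasure (Rel x) := by
    rw [chainLaw_succ, chainLaw_one]
    refine le_toOuterMeasure_bind (P₀ := {y | boolPair (h x) [] <+: y}) ?_ ?_
    · intro y hy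
      obtain ⟨w, hw, rfl⟩ := (PMF.mem_support_map_iff _ _ _).1 hy
      exact prefix_takeD (hsupp0 hw) (hlen_sd.trans (by rw [hpmeval]; exact Nat.le_add_right _ _))
    · intro y hy
      rw [PMF.toOuterMeasure_map_apply]
      set Ev : Set (List Bool) := R (h x) ∩ {t | t.length = (h x).length + F.ancillas (h x).length}
        with hEv
      have h1 : 2 / 3 + δ ≤ F.kernelProb A (h x) Ev := (hF (h x)).trans (by
        unfold QCircuitFamily.kernelProb
        refine ENNReal.toReal_mono (hne _ _) ((F.kernel A (h x)).toOuterMeasure_mono ?_)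
        rintro t ⟨ht, hts⟩
        exact ⟨ht, hlen F (h x) t hts⟩)
      have h2 := h1.trans (hS1 A x y hy Ev)
      have h3 : S.kernelProb A (stageInput x 1 y) {w | ∃ t ∈ Ev, g (boolPair x t) <+: w} ≤
          S.kernelProb A (stageInput x 1 y)
            ((fun w : List Bool => w.takeD (pm.eval n) false) ⁻¹' Rel x) := by
        refine kernelProb_mono _ _ _ ?_
        rintro w ⟨t, ⟨htR, htl⟩, htw⟩
        refine ⟨t, htR, prefix_takeD htw ?_⟩
        have hanc := (hpF (h x).length).2
        have hmono := TM2Iter.eval_mono pF hlen_hx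
        calc (g (boolPair x t)).length ≤ pg.eval (boolPair x t).length := hpg _
          _ ≤ pg.eval (2 * n + 2 + B₀.eval n + pF.eval (B₀.eval n)) :=
            TM2Iter.eval_mono pg (by rw [length_boolPair, htl, ← hn]; omega)
          _ ≤ pm.eval n := by rw [hpmeval]; exact Nat.le_add_left _ _
      have h4 := h2.trans h3
      unfold QCircuitFamily.kernelProb at h4
      exact (ENNReal.ofReal_le_iff_le_toReal (hne _ _)).2 h4
  -- the chain family carries the last window as a prefix
  have hchain := SeqChain.chainLaw_toOuterMeasure_le_kernel P x A (Rel x)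
  have hTn : SeqChain.Tn P x.length = 1 + 1 := by rw [SeqChain.Tn, hPT, eval_C]
  have hmn : SeqChain.mn P x.length = pm.eval n := by rw [SeqChain.mn, hPm]
  rw [hTn, hmn, hPS] at hchain
  have hsub : {w : List Bool | ∃ y ∈ Rel x, y <+: w} ⊆ Rel x :=
    fun w ⟨y, hy, hyw⟩ => hRelext x y hy w hyw
  have hfin := hc.trans (hchain.trans (((SeqChain.family P).kernel A x).toOuterMeasure.mono hsub))
  unfold QCircuitFamily.kernelProb
  exact (ENNReal.ofReal_le_iff_le_toReal (hne _ _)).1 hfin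

/-- **The same for an oracle-free solver** of `R` with success probability `≥ 2/3 + δ` (its
semantics does not depend on the oracle, `kernel_eq_of_isOracleFree`).
[cite: BennettBernsteinBrassardVazirani1997, Cor. 4.15 (BQP^BQP = BQP)] -/
theorem isQSolvable_of_isOracleFree {A : Language Bool} (hA : A ∈ BQP) {h g : List Bool → List Bool}
    (hh : h ∈ FPRel (Oracle.ofLanguage A)) (hg : g ∈ FP) {R : List Bool → Set (List Bool)}
    {F : QCircuitFamily cliffordT} (hfree : F.IsOracleFree) (hU : F.IsUniform) {δ : ℝ} (hδ : 0 < δ)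
    (hF : ∀ u, 2 / 3 + δ ≤ F.kernelProb 0 u (R u)) :
    IsQSolvable fun x => {z | ∃ y ∈ R (h x), g (boolPair x y) <+: z} :=
  isQSolvable_of_uniform hA hh hg hU hδ fun u => by
    unfold QCircuitFamily.kernelProb
    rw [kernel_eq_of_isOracleFree hfree A 0]
    exact hF u

/-- **Search-problem reading** (the form consumed by summit routes): `A ∈ BQP`, `h ∈ FP^A`, `g ∈ FP`,
and `R` solvable by an oracle-free uniform family with success probability bounded away from `2/3`
(`IsQSolvable` with slack) ⟹ the oracle-pre-processed, post-processed problem is `IsQSolvable`.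
Typical use: `A = FACT` (Shor), `h` = "factor the input and compute the instance data", `R` = one
Fourier-sampling experiment with its classical half (Hallgren 2005, §1).
[cite: BennettBernsteinBrassardVazirani1997, Cor. 4.15 (BQP^BQP = BQP)]
[cite: Hallgren2005, §1 and Thm. 1.1 (factor the discriminant, then one quantum period-finding stage)] -/
theorem isQSolvable_of_slack {A : Language Bool} (hA : A ∈ BQP) {h g : List Bool → List Bool}
    (hh : h ∈ FPRel (Oracle.ofLanguage A)) (hg : g ∈ FP) {R : List Bool → Set (List Bool)}
    (hR : ∃ F : QCircuitFamily cliffordT, F.IsOracleFree ∧ F.IsUniform ∧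
      ∃ δ : ℝ, 0 < δ ∧ ∀ u, 2 / 3 + δ ≤ F.kernelProb 0 u (R u)) :
    IsQSolvable fun x => {z | ∃ y ∈ R (h x), g (boolPair x y) <+: z} := by
  obtain ⟨F, hfree, hU, δ, hδ, hF⟩ := hR
  exact isQSolvable_of_isOracleFree hA hh hg hfree hU hδ hF

end OracleWrap

end Literature.Computability.QuantumComplexity

end
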